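import Literature.Geometry.Lorentzian.GreenIdentityCompactSupport
import Literature.Geometry.Lorentzian.InitialData
import HarnessLib

/-!
# Uniformly equivalent metrics: comparison of the inverse metrics and transfer of the Sobolev
# inequality (Schoen–Yau 1979, Lemma 3.1 along the family `ds² + t Ric`)

Schoen–Yau, Comm. Math. Phys. 65 (1979), proof of Thm. 2 (pp. 72–74) applies the linear theory of
Lemmas 3.1–3.3 to every metric of the family `ds²_t = ds² + t Ric` with constants independent of
`t` ("the estimates of Lemma 3.2 hold uniformly for `t` small", (3.28)–(3.29)). The mechanism is
that for `|t|` small the metrics `ds²_t` are *uniformly equivalent* to `ds²`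
(`Λ⁻¹ ds² ≤ ds²_t ≤ Λ ds²`), and uniformly equivalent metrics have comparable inverse metrics,
volumes and hence Sobolev constants (Lemma 3.1, p. 63: "`ds²` is uniformly equivalent to the
Euclidean metric, we have the inequality which follows from the Euclidean inequality"). This file
proves the two pointwise/abstract halves of that mechanism:

* `PseudoRiemannianMetric.innerDual_le_mul_innerDual_of_val_le` — for Riemannian metrics `g, g̃`
  on the same bundle with `g̃(v, v) ≤ Λ g(v, v)` on a fibre, the inverse metrics satisfy
  `g⁻¹(α, α) ≤ Λ g̃⁻¹(α, α)` there (Cauchy–Schwarz for `g̃` and the defining property of `♯`);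
* `sobolev_of_uniformlyEquivalent` — if `(X, h)` satisfies the Sobolev inequality
  `(∫ |ζ|⁶ dV_h)^{1/3} ≤ c₁ ∫ h⁻¹(dζ, dζ) dV_h` (`ζ ∈ C¹_c(X)`), `h̃(v,v) ≤ Λ h(v,v)`, and the
  Riemannian measures satisfy `dV_{h̃} ≤ C dV_h`, `dV_h ≤ C' dV_{h̃}`, then `(X, h̃)` satisfies the
  Sobolev inequality with constant `C^{1/3} c₁ Λ C'`.

The comparison of the Riemannian measures themselves (the hypotheses `dV_{h̃} ≤ C dV_h`) is the
subject of a separate file. All results are proved; no definitions, no named facts.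

## References

* R. Schoen, S.-T. Yau, *On the proof of the positive mass conjecture in general relativity*,
  Comm. Math. Phys. 65 (1979) 45–76, Lemma 3.1 (p. 63), (3.28)–(3.29) (p. 73).
* E. Hebey, *Nonlinear Analysis on Manifolds: Sobolev Spaces and Inequalities*, CIMS Lecture
  Notes 5 (1999), §2 (Sobolev constants of equivalent metrics).
-/

noncomputable section

open Set Function Filter MeasureTheory Measure TopologicalSpace Manifold Bundle Module
open scoped Topology Manifold ContDiff ENNReal

namespace Literature.Geometry.Lorentzian

/-! ### The inverse metrics of comparable metrics -/

namespace PseudoRiemannianMetric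

variable
  {EB : Type*} [NormedAddCommGroup EB] [NormedSpace ℝ EB]
  {HB : Type*} [TopologicalSpace HB] {IB : ModelWithCorners ℝ EB HB} {n : ℕ∞ω}
  {B : Type*} [TopologicalSpace B] [ChartedSpace HB B]
  {F : Type*} [NormedAddCommGroup F] [NormedSpace ℝ F] [FiniteDimensional ℝ F]
  {E : B → Type*} [TopologicalSpace (TotalSpace F E)]
  [∀ b, TopologicalSpace (E b)] [∀ b, AddCommGroup (E b)] [∀ b, Module ℝ (E b)]
  [FiberBundle F E] [VectorBundle ℝ F E]

/-- **Comparable Riemannian metrics have comparable inverse metrics.** If `g, g̃` are Riemannian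
metrics on the same vector bundle and `g̃_b(v, v) ≤ Λ g_b(v, v)` for all `v` in the fibre at `b`
(`Λ ≥ 0`), then `g_b⁻¹(α, α) ≤ Λ g̃_b⁻¹(α, α)` for every covector `α`. (With `v = ♯_g α`,
`u = ♯_{g̃} α`: `g⁻¹(α,α) = α(v) = g̃(u, v)`, and Cauchy–Schwarz for `g̃` gives
`α(v)² ≤ g̃(u,u) g̃(v,v) ≤ g̃⁻¹(α,α) · Λ g(v,v) = Λ g̃⁻¹(α,α) g⁻¹(α,α)`.) Hebey 1999, §2.
[folklore] -/
theorem innerDual_le_mul_innerDual_of_val_le {g g' : PseudoRiemannianMetric IB n F E}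
    (hg : g.IsRiemannian) (hg' : g'.IsRiemannian) {Λ : ℝ} (hΛ : 0 ≤ Λ) (b : B)
    (hcomp : ∀ v : E b, g'.val b v v ≤ Λ * g.val b v v) (α : Module.Dual ℝ (E b)) :
    g.innerDual b α α ≤ Λ * g'.innerDual b α α := by
  set v : E b := g.sharp b α with hv
  set u : E b := g'.sharp b α with hu
  have hA : g.innerDual b α α = g.val b v v := by
    rw [g.innerDual_eq_val_sharp_sharp]
  have hA' : g'.innerDual b α α = g'.val b u u := by
    rw [g'.innerDual_eq_val_sharp_sharp]
  have hαv : α v = g.val b v v := (g.val_sharp_apply b α v).symm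
  have hαv' : α v = g'.val b u v := (g'.val_sharp_apply b α v).symm
  have hnn : ∀ w : E b, 0 ≤ g.val b w w := fun w ↦ by
    by_cases hw : w = 0
    · simp [hw]
    · exact (hg b w hw).le
  have hnn' : ∀ w : E b, 0 ≤ g'.val b w w := fun w ↦ by
    by_cases hw : w = 0
    · simp [hw]
    · exact (hg' b w hw).le
  -- Cauchy–Schwarz for `g'`
  have hCS : (g'.val b u v) ^ 2 ≤ g'.val b u u * g'.val b v v := by
    have h := (g'.toBilinForm b).apply_sq_le_of_symm (fun w ↦ by simpa using hnn' w)
      (LinearMap.BilinForm.isSymm_iff.1 (g'.isSymm_toBilinForm b)) u v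
    simpa using h
  set A : ℝ := g.val b v v with hAdef
  set A' : ℝ := g'.val b u u with hA'def
  have hA0 : 0 ≤ A := hnn v
  have hA'0 : 0 ≤ A' := hnn' u
  have hkey : A ^ 2 ≤ Λ * A' * A := by
    calc A ^ 2 = (g'.val b u v) ^ 2 := by rw [← hαv', hαv]
      _ ≤ A' * g'.val b v v := hCS
      _ ≤ A' * (Λ * A) := mul_le_mul_of_nonneg_left (hcomp v) hA'0
      _ = Λ * A' * A := by ring
  rw [hA, hA']
  change A ≤ Λ * A'
  rcases hA0.eq_or_lt with h0 | hpos
  · rw [← h0]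
    exact mul_nonneg hΛ hA'0
  · exact le_of_mul_le_mul_right (by nlinarith) hpos

end PseudoRiemannianMetric

/-! ### Transfer of the Sobolev inequality to a uniformly equivalent metric -/

section Sobolev

variable {X : Type} [TopologicalSpace X] [ChartedSpace (EuclideanSpace ℝ (Fin 3)) X]
  [IsManifold (𝓡 3) ∞ X] [T2Space X] [LocallyCompactSpace X] [MeasurableSpace X] [BorelSpace X]

/-- The Dirichlet integrand `h⁻¹(dζ, dζ)` of a `C¹` compactly supported function is continuous,
nonnegative and compactly supported, hence integrable for the Riemannian measure. [folklore] -/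
theorem integrable_innerDual_mvfderiv_of_hasCompactSupport (D : InitialDataSet (𝓡 3) X)
    [D.metric.HasLeviCivita] {ζ : X → ℝ} (hζ : ContMDiff (𝓡 3) 𝓘(ℝ, ℝ) 1 ζ)
    (hζc : HasCompactSupport ζ) :
    Integrable (fun x ↦ D.metric.innerDual x (mvfderiv (𝓡 3) ζ x).toLinearMap
      (mvfderiv (𝓡 3) ζ x).toLinearMap) (riemannianMeasure D.h) := by
  haveI : IsFiniteMeasureOnCompacts (riemannianMeasure D.h) :=
    ⟨fun K hK ↦ riemannianVolume_lt_top_of_isCompact_holds D.h le_rfl hK⟩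
  refine (continuous_innerDual_mvfderiv D.metric hζ hζ).integrable_of_hasCompactSupport ?_
  refine HasCompactSupport.intro hζc fun x hx ↦ ?_
  have hev : ζ =ᶠ[𝓝 x] fun _ ↦ 0 := notMem_tsupport_iff_eventuallyEq.1 hx
  simp only [PseudoRiemannianMetric.mvfderiv_eq_zero_of_eventuallyEq_zero hev,
    ContinuousLinearMap.toLinearMap_zero, PseudoRiemannianMetric.innerDual, LinearMap.zero_apply]

/-- **The Sobolev inequality passes to a uniformly equivalent metric** (the mechanism behind the
uniformity in `t` of the constants of Schoen–Yau 1979, Lemmas 3.1–3.2 along `ds² + t Ric`,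
(3.28)–(3.29)). Let `h, h̃` be the metrics of two data sets on the `3`-manifold `X` with
`h̃(v, v) ≤ Λ h(v, v)` pointwise (`Λ ≥ 0`), Riemannian measures `dV_{h̃} ≤ C dV_h` and
`dV_h ≤ C' dV_{h̃}` (`C, C' ≥ 0`), and suppose `(X, h)` satisfies
`(∫ |ζ|⁶ dV_h)^{1/3} ≤ c₁ ∫ h⁻¹(dζ, dζ) dV_h` for `ζ ∈ C¹_c(X)` (`c₁ ≥ 0`). Then `(X, h̃)` satisfies
the same inequality with constant `C^{1/3} c₁ Λ C'`:
`(∫ |ζ|⁶ dV_{h̃})^{1/3} ≤ (C ∫ |ζ|⁶ dV_h)^{1/3} ≤ C^{1/3} c₁ ∫ h⁻¹(dζ,dζ) dV_h ≤ C^{1/3} c₁ Λ ∫ h̃⁻¹(dζ,dζ) dV_h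
≤ C^{1/3} c₁ Λ C' ∫ h̃⁻¹(dζ,dζ) dV_{h̃}` (`innerDual_le_mul_innerDual_of_val_le`).
[cite: SchoenYauPMT1979, Lemma 3.1 (p. 63) and (3.28)–(3.29) (p. 73)] -/
theorem sobolev_of_uniformlyEquivalent (D D' : InitialDataSet (𝓡 3) X) [D.metric.HasLeviCivita]
    [D'.metric.HasLeviCivita] {Λ C C' c₁ : ℝ} (hΛ : 0 ≤ Λ) (hC : 0 ≤ C) (hC' : 0 ≤ C') (hc₁ : 0 ≤ c₁)
    (hcomp : ∀ (x : X) (v : TangentSpace (𝓡 3) x), D'.metric.val x v v ≤ Λ * D.metric.val x v v)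
    (hμ : riemannianMeasure D'.h ≤ ENNReal.ofReal C • riemannianMeasure D.h)
    (hμ' : riemannianMeasure D.h ≤ ENNReal.ofReal C' • riemannianMeasure D'.h)
    (hS : ∀ ζ : X → ℝ, ContMDiff (𝓡 3) 𝓘(ℝ, ℝ) 1 ζ → HasCompactSupport ζ →
      (∫ x, |ζ x| ^ 6 ∂riemannianMeasure D.h) ^ (1 / 3 : ℝ) ≤
        c₁ * ∫ x, D.metric.innerDual x (mvfderiv (𝓡 3) ζ x).toLinearMap
          (mvfderiv (𝓡 3) ζ x).toLinearMap ∂riemannianMeasure D.h) :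
    ∀ ζ : X → ℝ, ContMDiff (𝓡 3) 𝓘(ℝ, ℝ) 1 ζ → HasCompactSupport ζ →
      (∫ x, |ζ x| ^ 6 ∂riemannianMeasure D'.h) ^ (1 / 3 : ℝ) ≤
        (C ^ (1 / 3 : ℝ) * c₁ * Λ * C') * ∫ x, D'.metric.innerDual x (mvfderiv (𝓡 3) ζ x).toLinearMap
          (mvfderiv (𝓡 3) ζ x).toLinearMap ∂riemannianMeasure D'.h := by
  intro ζ hζ hζc
  set μ : Measure X := riemannianMeasure D.h with hμdef
  set μ' : Measure X := riemannianMeasure D'.h with hμ'def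
  haveI : IsFiniteMeasureOnCompacts μ :=
    ⟨fun K hK ↦ riemannianVolume_lt_top_of_isCompact_holds D.h le_rfl hK⟩
  haveI : IsFiniteMeasureOnCompacts μ' :=
    ⟨fun K hK ↦ riemannianVolume_lt_top_of_isCompact_holds D'.h le_rfl hK⟩
  set ID : X → ℝ := fun x ↦ D.metric.innerDual x (mvfderiv (𝓡 3) ζ x).toLinearMap
    (mvfderiv (𝓡 3) ζ x).toLinearMap with hID
  set ID' : X → ℝ := fun x ↦ D'.metric.innerDual x (mvfderiv (𝓡 3) ζ x).toLinearMap
    (mvfderiv (𝓡 3) ζ x).toLinearMap with hID'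
  have hID0 : ∀ x, 0 ≤ ID x := fun x ↦ innerDual_self_nonneg D.h x _
  have hID'0 : ∀ x, 0 ≤ ID' x := fun x ↦ innerDual_self_nonneg D'.h x _
  have hIDle : ∀ x, ID x ≤ Λ * ID' x := fun x ↦
    PseudoRiemannianMetric.innerDual_le_mul_innerDual_of_val_le D.isRiemannian_metric
      D'.isRiemannian_metric hΛ x (hcomp x) _
  have hIDi : Integrable ID μ := integrable_innerDual_mvfderiv_of_hasCompactSupport D hζ hζc
  have hID'i : Integrable ID' μ' := integrable_innerDual_mvfderiv_of_hasCompactSupport D' hζ hζc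
  have hID'iμ : Integrable ID' μ := by
    refine (hID'i.smul_measure (c := ENNReal.ofReal C') ENNReal.ofReal_ne_top).mono_measure hμ'
  -- the `L⁶` side
  have hζcont : Continuous ζ := hζ.continuous
  have h6c : HasCompactSupport fun x ↦ |ζ x| ^ 6 := hζc.comp_left (g := fun t : ℝ ↦ |t| ^ 6) (by simp)
  have h6i : Integrable (fun x ↦ |ζ x| ^ 6) μ :=
    ((hζcont.abs).pow 6).integrable_of_hasCompactSupport h6c
  have h6i' : Integrable (fun x ↦ |ζ x| ^ 6) (ENNReal.ofReal C • μ) :=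
    h6i.smul_measure ENNReal.ofReal_ne_top
  have hI0 : 0 ≤ ∫ x, |ζ x| ^ 6 ∂μ := integral_nonneg fun x ↦ by positivity
  have hL : ∫ x, |ζ x| ^ 6 ∂μ' ≤ C * ∫ x, |ζ x| ^ 6 ∂μ := by
    have h := integral_mono_measure hμ (ae_of_all _ fun x ↦ by positivity) h6i'
    rw [integral_smul_measure, ENNReal.toReal_ofReal hC, smul_eq_mul] at h
    exact h
  have hL' : (∫ x, |ζ x| ^ 6 ∂μ') ^ (1 / 3 : ℝ) ≤ C ^ (1 / 3 : ℝ) * (∫ x, |ζ x| ^ 6 ∂μ) ^ (1 / 3 : ℝ) := by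
    rw [← Real.mul_rpow hC hI0]
    exact Real.rpow_le_rpow (integral_nonneg fun x ↦ by positivity) hL (by norm_num)
  -- the Dirichlet side
  have hE : ∫ x, ID x ∂μ ≤ Λ * C' * ∫ x, ID' x ∂μ' := by
    have h1 : ∫ x, ID x ∂μ ≤ ∫ x, Λ * ID' x ∂μ :=
      integral_mono hIDi (hID'iμ.const_mul Λ) hIDle
    have h2 : ∫ x, ID' x ∂μ ≤ C' * ∫ x, ID' x ∂μ' := by
      have h := integral_mono_measure hμ' (ae_of_all _ fun x ↦ hID'0 x)
        (hID'i.smul_measure ENNReal.ofReal_ne_top)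
      rw [integral_smul_measure, ENNReal.toReal_ofReal hC', smul_eq_mul] at h
      exact h
    rw [integral_const_mul] at h1
    calc ∫ x, ID x ∂μ ≤ Λ * ∫ x, ID' x ∂μ := h1
      _ ≤ Λ * (C' * ∫ x, ID' x ∂μ') := mul_le_mul_of_nonneg_left h2 hΛ
      _ = Λ * C' * ∫ x, ID' x ∂μ' := by ring
  have hI'0 : 0 ≤ ∫ x, ID' x ∂μ' := integral_nonneg hID'0
  calc (∫ x, |ζ x| ^ 6 ∂μ') ^ (1 / 3 : ℝ)
      ≤ C ^ (1 / 3 : ℝ) * (∫ x, |ζ x| ^ 6 ∂μ) ^ (1 / 3 : ℝ) := hL'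
    _ ≤ C ^ (1 / 3 : ℝ) * (c₁ * ∫ x, ID x ∂μ) :=
        mul_le_mul_of_nonneg_left (hS ζ hζ hζc) (Real.rpow_nonneg hC _)
    _ ≤ C ^ (1 / 3 : ℝ) * (c₁ * (Λ * C' * ∫ x, ID' x ∂μ')) :=
        mul_le_mul_of_nonneg_left (mul_le_mul_of_nonneg_left hE hc₁) (Real.rpow_nonneg hC _)
    _ = (C ^ (1 / 3 : ℝ) * c₁ * Λ * C') * ∫ x, ID' x ∂μ' := by ring

end Sobolev

end Literature.Geometry.Lorentzian

end
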